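import Literature.Computability.AlgebraicComplexity.BlockWalks
import HarnessLib

/-!
# The block layout of `IMM^*` and its good closed walks (Kumar–Saraf 2017, §8.1)

Topic `Literature/Computability/AlgebraicComplexity`; infrastructure for the printed proof of
`kumarSaraf2017_imm_homDepthFour` (`HomogeneousDepthFour.lean`), Step 2 of the roadmap: the
arithmetic of the layout of `IMM^*` [KS, §8.1] — `r` blocks, each consisting of a special matrix
`Y`, `k` regular matrices `X_0, …, X_{k-1}` and an all-ones matrix `J` (block length `k + 2`),
followed here by `e` identity layers (so that the number of matrices `n = r (k+2) + e` is
arbitrary) — and the dictionary between the closed walks that survive the substitution and pass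
through a transversal `α` of the special matrices ("good walks") and tuples of block walks
(`KumarSaraf.Walk`, `BlockWalks.lean`):

* `nL r k e = r (k+2) + e`; positions `posY b` (before `Y`), `posX b i` (regular part); the arithmetic
  of positions (`div`/`mod` by the block length).
* `GoodWalk ξ α v` — the closed walk `v : Fin n → Fin ñ` is at the row `0` before every `Y`, at
  `α b` after it, uses only entries kept by `ξ b` in the regular layers of block `b`, and stays at
  `0` on the identity layers; `blockGood ξ α b` — the block walks from `α b` alive under `ξ b`.
* `toBlocks`, `ofBlocks` and **`sum_goodWalks_eq_sum_pi`**: summing a function over the good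
  walks is summing it over the product over the blocks of the good block walks
  (`Fintype.piFinset`) — the identification `S(α) = ∏_i S(α)^{(i)}` of [KS, §8.1].
* `card_blockGood` — from a fixed start there are exactly `∏_j deg_j` alive block walks when every
  row of layer `j` keeps `deg_j` entries (the count `D^{k'}` per block behind [KS, Lemma 8.3]), and
  **`card_goodWalks`**: `#good walks = (∏_j deg_j)^r`.

Everything is proved; no named facts. The identification of the good walks with the support of
`∂_α ρ_{J,V} IMM` is in `IMMStarWalks.lean`.

## References

* M. Kumar, S. Saraf, *On the power of homogeneous depth 4 arithmetic circuits*, SIAM J. Comput.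
  46 (2017) 336–387 (arXiv:1404.1950): §8.1 (`IMM^*`, blocks, `S(α)`), §8.3, Lemma 8.3.
-/

namespace Literature.Computability.AlgebraicComplexity.KumarSaraf

open Finset

/-! ### Layout arithmetic -/

/-- The number of matrices: `r` blocks and `e` identity layers. [cite: KumarSaraf2017, §8.1] -/
abbrev nL (r k e : ℕ) : ℕ := r * (k + 2) + e

variable {r k e N : ℕ}

/-- The position (vertex index) of the vertex before the special matrix `Y` of block `b`.
[cite: KumarSaraf2017, §8.1] -/
def posY (b : Fin r) : Fin (nL r k e) :=
  ⟨(b : ℕ) * (k + 2), by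
    have := b.2; unfold nL at *; nlinarith⟩

/-- The position of the `i`-th vertex of the regular part of block `b` (`i = 0`: after `Y`,
`i = k`: before `J`). [cite: KumarSaraf2017, §8.1] -/
def posX (b : Fin r) (i : Fin (k + 1)) : Fin (nL r k e) :=
  ⟨(b : ℕ) * (k + 2) + 1 + i, by
    have hb := b.2; have hi := i.2; unfold nL at *; nlinarith⟩

/-- Value of `posY`. [folklore] -/
@[simp] theorem posY_val (b : Fin r) : ((posY (k := k) (e := e) b : Fin (nL r k e)) : ℕ) = b * (k + 2) := rfl

/-- Value of `posX`. [folklore] -/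
@[simp] theorem posX_val (b : Fin r) (i : Fin (k + 1)) :
    ((posX (e := e) b i : Fin (nL r k e)) : ℕ) = b * (k + 2) + 1 + i := rfl

/-- Positions inside the blocks decompose uniquely. [folklore] -/
theorem div_mod_of_lt {t : ℕ} (ht : t < r * (k + 2)) :
    t / (k + 2) < r ∧ t = t / (k + 2) * (k + 2) + t % (k + 2) ∧ t % (k + 2) < (k + 2) := by
  refine ⟨(Nat.div_lt_iff_lt_mul (by omega)).2 ht, ?_, Nat.mod_lt _ (by omega)⟩
  have := Nat.div_add_mod' t ((k + 2))
  omega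

/-- `div`/`mod` of a position `b (k+2) + i`, `i < k + 2`. [folklore] -/
theorem pos_div_mod (b i : ℕ) (hi : i < (k + 2)) :
    (b * (k + 2) + i) / (k + 2) = b ∧ (b * (k + 2) + i) % (k + 2) = i := by
  have hpos : 0 < (k + 2) := by omega
  constructor
  · rw [Nat.add_comm, Nat.add_mul_div_right _ _ hpos, Nat.div_eq_of_lt hi, zero_add]
  · rw [Nat.add_comm, Nat.add_mul_mod_self_right, Nat.mod_eq_of_lt hi]

/-- Positions of the same shape are equal only blockwise. [folklore] -/
theorem pos_inj {b b' i i' : ℕ} (hi : i < (k + 2)) (hi' : i' < (k + 2))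
    (h : b * (k + 2) + i = b' * (k + 2) + i') : b = b' ∧ i = i' := by
  have h1 := pos_div_mod (k := k) b i hi
  have h2 := pos_div_mod (k := k) b' i' hi'
  rw [h] at h1
  exact ⟨h1.1.symm.trans h2.1, h1.2.symm.trans h2.2⟩

/-! ### Good walks and block walks -/

variable (hN : 0 < N)

/-- The vertex `0`. [folklore] -/
def v0 (hN : 0 < N) : Fin N := ⟨0, hN⟩

/-- **Good closed walks** for the row choices `ξ` (block `b`, layer `j`, row `u` ↦ kept columns)
and the transversal `α` (the chosen alive first-row entry of every `Y`): at `0` before every `Y`,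
at `α b` after it, alive in the regular layers, at `0` on the identity layers.
[cite: KumarSaraf2017, §8.1] -/
def GoodWalk (ξ : Fin r → Fin k × Fin N → Finset (Fin N)) (α : Fin r → Fin N)
    (v : Fin (nL r k e) → Fin N) : Prop :=
  (∀ b : Fin r, v (posY b) = v0 hN ∧ v (posX b 0) = α b) ∧
  (∀ (b : Fin r) (j : Fin k), v (posX b j.succ) ∈ ξ b (j, v (posX b j.castSucc))) ∧
  (∀ t : Fin (nL r k e), r * (k + 2) ≤ (t : ℕ) → v t = v0 hN)

/-- Goodness is decidable. [folklore] -/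
instance GoodWalk.decidable (ξ : Fin r → Fin k × Fin N → Finset (Fin N)) (α : Fin r → Fin N)
    (v : Fin (nL r k e) → Fin N) : Decidable (GoodWalk (e := e) hN ξ α v) := by
  unfold GoodWalk; infer_instance

/-- The good walks, as a finite set. [cite: KumarSaraf2017, §8.1] -/
def goodWalks (ξ : Fin r → Fin k × Fin N → Finset (Fin N)) (α : Fin r → Fin N) :
    Finset (Fin (nL r k e) → Fin N) :=
  univ.filter fun v => GoodWalk hN ξ α v

/-- The good block walks of block `b`: from `α b`, alive under `ξ b`. [cite: KumarSaraf2017, §8.1] -/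
def blockGood (ξ : Fin r → Fin k × Fin N → Finset (Fin N)) (α : Fin r → Fin N) (b : Fin r) :
    Finset (Walk k N) :=
  univ.filter fun p => p 0 = α b ∧ Alive (ξ b) p

/-- The block walks of a closed walk. [cite: KumarSaraf2017, §8.1] -/
def toBlocks (v : Fin (nL r k e) → Fin N) : Fin r → Walk k N := fun b i => v (posX b i)

/-- The closed walk of a tuple of block walks (at `0` before every `Y` and on the identity
layers). [cite: KumarSaraf2017, §8.1] -/
def ofBlocks (p : Fin r → Walk k N) : Fin (nL r k e) → Fin N := fun t =>
  if ht : (t : ℕ) < r * (k + 2) then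
    if h0 : (t : ℕ) % (k + 2) = 0 then v0 hN
    else p ⟨(t : ℕ) / (k + 2), (div_mod_of_lt ht).1⟩
      ⟨(t : ℕ) % (k + 2) - 1, by have := (div_mod_of_lt ht).2.2; omega⟩
  else v0 hN

/-- `ofBlocks` at the vertex before `Y`. [folklore] -/
theorem ofBlocks_posY (p : Fin r → Walk k N) (b : Fin r) :
    ofBlocks (e := e) hN p (posY b) = v0 hN := by
  unfold ofBlocks
  have hlt : ((posY (k := k) (e := e) b : Fin (nL r k e)) : ℕ) < r * (k + 2) := by
    rw [posY_val]; have := b.2; nlinarith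
  rw [dif_pos hlt]
  have := (pos_div_mod (k := k) b 0 (by omega)).2
  rw [add_zero] at this
  rw [dif_pos (by rw [posY_val]; exact this)]

/-- `ofBlocks` in the regular part. [folklore] -/
theorem ofBlocks_posX (p : Fin r → Walk k N) (b : Fin r) (i : Fin (k + 1)) :
    ofBlocks (e := e) hN p (posX b i) = p b i := by
  unfold ofBlocks
  have hi : 1 + (i : ℕ) < (k + 2) := by have := i.2; omega
  have hlt : ((posX (e := e) b i : Fin (nL r k e)) : ℕ) < r * (k + 2) := by
    rw [posX_val]; have := b.2; nlinarith
  rw [dif_pos hlt]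
  have hdm := pos_div_mod (k := k) b (1 + i) hi
  rw [← add_assoc] at hdm
  have hval : ((posX (e := e) b i : Fin (nL r k e)) : ℕ) = b * (k + 2) + 1 + i := rfl
  rw [dif_neg (by rw [hval, hdm.2]; omega)]
  congr 1
  · exact Fin.ext (by rw [Fin.val_mk, hval, hdm.1])
  · exact Fin.ext (by simp only [hval, hdm.2]; omega)

/-- `ofBlocks` on the identity layers. [folklore] -/
theorem ofBlocks_of_le (p : Fin r → Walk k N) (t : Fin (nL r k e)) (ht : r * (k + 2) ≤ (t : ℕ)) :
    ofBlocks hN p t = v0 hN := by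
  unfold ofBlocks
  rw [dif_neg (not_lt.2 ht)]

/-- **Good walks correspond to tuples of good block walks** ("`S(α) = ∏_i S(α)^{(i)}`",
[KS, §8.1]): summing over the good walks is summing over the product of the good block walks.
[cite: KumarSaraf2017, §8.1] -/
theorem sum_goodWalks_eq_sum_pi {M : Type*} [AddCommMonoid M]
    (ξ : Fin r → Fin k × Fin N → Finset (Fin N)) (α : Fin r → Fin N)
    (F : (Fin (nL r k e) → Fin N) → M) :
    ∑ v ∈ goodWalks (e := e) hN ξ α, F v =
      ∑ p ∈ Fintype.piFinset (blockGood ξ α), F (ofBlocks hN p) := by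
  classical
  have hleft : ∀ v ∈ goodWalks (e := e) hN ξ α, ofBlocks hN (toBlocks (e := e) v) = v := by
    intro v hv
    rw [goodWalks, mem_filter] at hv
    obtain ⟨-, h1, -, h3⟩ := hv
    funext t
    by_cases ht : (t : ℕ) < r * (k + 2)
    · obtain ⟨hb, heq, hi⟩ := div_mod_of_lt ht
      by_cases h0 : (t : ℕ) % (k + 2) = 0
      · have : t = posY ⟨(t : ℕ) / (k + 2), hb⟩ :=
          Fin.ext (by simp only [posY_val]; omega)
        rw [this, ofBlocks_posY, (h1 _).1]
      · have hi' : (t : ℕ) % (k + 2) - 1 < k + 1 := by omega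
        have : t = posX ⟨(t : ℕ) / (k + 2), hb⟩ ⟨(t : ℕ) % (k + 2) - 1, hi'⟩ :=
          Fin.ext (by simp only [posX_val]; omega)
        rw [this, ofBlocks_posX]
        rfl
    · rw [ofBlocks_of_le hN _ t (not_lt.1 ht), h3 t (not_lt.1 ht)]
  refine sum_nbij' (toBlocks (e := e)) (ofBlocks hN) ?_ ?_ ?_ ?_ ?_
  · -- good walks have good blocks
    intro v hv
    rw [goodWalks, mem_filter] at hv
    obtain ⟨-, h1, h2, -⟩ := hv
    rw [Fintype.mem_piFinset]
    intro b
    rw [blockGood, mem_filter]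
    exact ⟨mem_univ _, (h1 b).2, fun j => h2 b j⟩
  · -- tuples of good blocks give good walks
    intro p hp
    rw [Fintype.mem_piFinset] at hp
    rw [goodWalks, mem_filter]
    refine ⟨mem_univ _, fun b => ⟨ofBlocks_posY hN p b, ?_⟩, fun b j => ?_, fun t ht => ofBlocks_of_le hN p t ht⟩
    · rw [ofBlocks_posX]; exact ((mem_filter.1 (hp b)).2).1
    · rw [ofBlocks_posX, ofBlocks_posX]; exact ((mem_filter.1 (hp b)).2).2 j
  · -- `ofBlocks ∘ toBlocks = id` on good walks
    intro v hv; exact hleft v hv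
  · -- `toBlocks ∘ ofBlocks = id`
    intro p _
    funext b i
    exact ofBlocks_posX hN p b i
  · intro v hv; rw [hleft v hv]

/-! ### Counting the good walks -/

/-- Restricting the row choices to the first `k` of `k + 1` layers. [folklore] -/
def initRows (ξ : Fin (k + 1) × Fin N → Finset (Fin N)) : Fin k × Fin N → Finset (Fin N) :=
  fun ρ => ξ (ρ.1.castSucc, ρ.2)

/-- **From a fixed start there are exactly `∏_j deg_j` alive block walks** when every row of
layer `j` keeps `deg_j` entries (the walk chooses one of the `deg_j` kept entries of its current
row at each layer): the count `D^{k'}` per block of [KS, Lemma 8.3]. [cite: KumarSaraf2017, Lemma 8.3] -/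
theorem card_alive_from : ∀ (k : ℕ) (ξ : Fin k × Fin N → Finset (Fin N)) (deg : Fin k → ℕ)
    (_ : ∀ j u, (ξ (j, u)).card = deg j) (s : Fin N),
    ((univ : Finset (Walk k N)).filter fun p => p 0 = s ∧ Alive ξ p).card = ∏ j, deg j := by
  intro k
  induction k with
  | zero =>
    intro ξ deg _ s
    rw [Fintype.prod_empty, card_eq_one]
    refine ⟨fun _ => s, ?_⟩
    ext p
    simp only [mem_filter, mem_univ, true_and, mem_singleton, Alive, IsEmpty.forall_iff, and_true]
    constructor
    · intro h; funext i; rw [Fin.eq_zero i, h]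
    · rintro rfl; rfl
  | succ k ih =>
    intro ξ deg hξ s
    classical
    have hih := ih (initRows ξ) (fun j => deg j.castSucc) (fun j u => hξ j.castSucc u) s
    set Sk := (univ : Finset (Walk k N)).filter fun q => q 0 = s ∧ Alive (initRows ξ) q with hSk
    rw [Fin.prod_univ_castSucc, ← hih]
    -- `p ↦ (init p, p last)` is a bijection onto `Sk.sigma (q ↦ ξ (last, q last))`
    have hcount : ((univ : Finset (Walk (k + 1) N)).filter fun p => p 0 = s ∧ Alive ξ p).card =
        (Sk.sigma fun q => ξ (Fin.last k, q (Fin.last k))).card := by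
      refine card_nbij' (fun p => ⟨Fin.init p, p (Fin.last (k + 1))⟩)
        (fun x => Fin.snoc x.1 x.2) ?_ ?_ ?_ ?_
      · intro p hp
        rw [mem_coe, mem_filter] at hp
        obtain ⟨-, h0, ha⟩ := hp
        rw [mem_coe, mem_sigma, hSk, mem_filter]
        refine ⟨⟨mem_univ _, ?_, fun j => ?_⟩, ?_⟩
        · exact h0
        · have h := ha j.castSucc
          rw [Fin.succ_castSucc] at h
          exact h
        · have h := ha (Fin.last k)
          rw [Fin.succ_last] at h
          exact h
      · rintro ⟨q, c⟩ hx
        rw [mem_coe, mem_sigma, hSk, mem_filter] at hx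
        obtain ⟨⟨-, hq0, hqa⟩, hc⟩ := hx
        rw [mem_coe, mem_filter]
        dsimp only
        refine ⟨mem_univ _, ?_, fun j => ?_⟩
        · have : (0 : Fin (k + 1 + 1)) = (0 : Fin (k + 1)).castSucc := rfl
          rw [this, Fin.snoc_castSucc]; exact hq0
        · rcases Fin.eq_castSucc_or_eq_last j with ⟨j', rfl⟩ | rfl
          · rw [Fin.succ_castSucc, Fin.snoc_castSucc, Fin.snoc_castSucc]; exact hqa j'
          · rw [Fin.succ_last, Fin.snoc_last, Fin.snoc_castSucc]; exact hc
      · intro p _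
        exact Fin.snoc_init_self p
      · rintro ⟨q, c⟩ _
        dsimp only
        rw [Fin.init_snoc, Fin.snoc_last]
    rw [hcount, card_sigma]
    rw [sum_congr rfl fun q _ => hξ (Fin.last k) (q (Fin.last k)), sum_const, smul_eq_mul]

/-- Alive block walks from `α b`: exactly `∏_j deg_j`. [cite: KumarSaraf2017, Lemma 8.3] -/
theorem card_blockGood (ξ : Fin r → Fin k × Fin N → Finset (Fin N)) (α : Fin r → Fin N)
    (deg : Fin k → ℕ) (hξ : ∀ b j u, (ξ b (j, u)).card = deg j) (b : Fin r) :
    (blockGood ξ α b).card = ∏ j, deg j :=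
  card_alive_from k (ξ b) deg (hξ b) (α b)

/-- **The number of good walks is `(∏_j deg_j)^r`** (for every choice `ξ` in the support of the
distribution: [KS, Lemma 8.3], "for all `V`, `T₁|_V(α) = D^k · C(N-k, m)`").
[cite: KumarSaraf2017, Lemma 8.3] -/
theorem card_goodWalks (ξ : Fin r → Fin k × Fin N → Finset (Fin N)) (α : Fin r → Fin N)
    (deg : Fin k → ℕ) (hξ : ∀ b j u, (ξ b (j, u)).card = deg j) :
    (goodWalks (e := e) hN ξ α).card = (∏ j, deg j) ^ r := by
  classical
  have h := sum_goodWalks_eq_sum_pi (e := e) hN ξ α (fun _ => (1 : ℕ))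
  rw [sum_const, smul_eq_mul, mul_one, sum_const, smul_eq_mul, mul_one, Fintype.card_piFinset] at h
  rw [h, prod_congr rfl fun b _ => card_blockGood ξ α deg hξ b, prod_const, card_univ,
    Fintype.card_fin]

end Literature.Computability.AlgebraicComplexity.KumarSaraf
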